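import Summits.Schanuel.Schanuel.Theses.RoyCriterion

/-!
# Crux triage r1/k2 evidence — the `ℚ̄`-stratum of `RoyThesisTyped` is already a corollary of tree theorems

Cards `liouville-window-ladder` (its `AlgebraicSlice` = "rung 0", every rank) and
`liouville-saturation-ze-edge` (its `RoyHypothesisFailsAtAlgebraicPoints`, "X on the ℚ̄-stratum,
all ranks") both advertise, as the provable-now pay-off of their common lever (Liouville saturation
+ Philippon's zero estimate in Roy's oversaturated box), the statement below.  It is ALREADY a
three-line corollary of theorems in the tree, with no zero estimate and no new Liouville step:
`royConditionB_of_royHypothesis` (restrict the box to `m = m·e_0`), `royThm1BtoA_holds`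
(Roy 2001 Thm 1 `(b) ⇒ (a)`, discharged via Prop. 3) and `transcendental_exp_holds`
(Hermite–Lindemann, discharged).  So the cards' lever yields a SECOND proof of a statement the
tree has, not new reach on the crux; the residual of both cards is Schanuel rank by rank.
-/

noncomputable section

open Complex Literature.NumberTheory.Transcendental

namespace TriageR1K2

/-- Verbatim `Ideate2.RoyHypothesisFailsAtAlgebraicPoints` (card liouville-saturation-ze-edge,
SketchIdeator2.lean §3) = `LiouvilleWindowLadder.AlgebraicSlice` (card liouville-window-ladder,
Sketch-ideator1-r1.lean) up to the order of binders. -/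
def RoyHypothesisFailsAtAlgebraicPoints : Prop :=
  ∀ (l : ℕ) (y α : Fin l → ℂ), 1 ≤ l → LinearIndependent ℚ y → (∀ j, α j ≠ 0) →
    (∀ j, IsAlgebraic ℚ (y j)) → (∀ j, IsAlgebraic ℚ (α j)) →
    ∀ (s₀ s₁ t₀ t₁ u : ℝ), RoyAdmissible s₀ s₁ t₀ t₁ u → ¬ RoyHypothesis y α s₀ s₁ t₀ t₁ u

/-- The stratum statement from tree facts only (Roy Thm 1 `(b)⇒(a)` on the first generator +
Hermite–Lindemann). [folklore] -/
theorem royHypothesisFailsAtAlgebraicPoints_known : RoyHypothesisFailsAtAlgebraicPoints := by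
  intro l y α hl hy hα hya hαa s₀ s₁ t₀ t₁ u hadm hhyp
  set j : Fin l := ⟨0, hl⟩
  obtain ⟨d, hd1, hd⟩ := royThm1BtoA_holds (y j) (α j) (hα j) s₀ s₁ t₀ t₁ u hadm
    (royConditionB_of_royHypothesis hhyp j)
  have hy0 : y j ≠ 0 := hy.ne_zero j
  have hd0 : (d : ℂ) ≠ 0 := by exact_mod_cast (show d ≠ 0 by omega)
  have hne : (d : ℂ) * y j ≠ 0 := mul_ne_zero hd0 hy0
  have halg : IsAlgebraic ℚ ((d : ℂ) * y j) := (isAlgebraic_nat d).mul (hya j)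
  have hexp : IsAlgebraic ℚ (cexp ((d : ℂ) * y j)) := by
    rw [← hd]
    exact (hαa j).pow d
  exact transcendental_exp_holds halg hne hexp

/-- Card liouville-window-ladder's `AlgebraicSlice`, verbatim binder order. [folklore] -/
theorem algebraicSlice_known :
    ∀ (l : ℕ), 1 ≤ l → ∀ (y α : Fin l → ℂ), LinearIndependent ℚ y → (∀ j, α j ≠ 0) →
      (∀ j, IsAlgebraic ℚ (y j)) → (∀ j, IsAlgebraic ℚ (α j)) →
      ∀ (s₀ s₁ t₀ t₁ u : ℝ), RoyAdmissible s₀ s₁ t₀ t₁ u → ¬ RoyHypothesis y α s₀ s₁ t₀ t₁ u :=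
  fun l hl y α hy hα hya hαa => royHypothesisFailsAtAlgebraicPoints_known l y α hl hy hα hya hαa

-- `RoyCriterion 1` itself (card 2's `RankOneDirect` target, card 1's "direct proof of
-- RoyCriterionRankOne") is CLOSED in tree unconditionally:
-- `Summit.Schanuel.Schanuel.Theorems.RoyCriterion.RoyCriterionRankOne_proof`
-- (Summits/Schanuel/Schanuel/Theorems/RoyCriterionRoyCriterionRankOne.lean).


/-! ## Card identity-exact-window: the shifted window `R''` versus Roy's window (1)

`RoyAdmissibleBelow` (SketchIdeator3.lean, verbatim) is DISJOINT from `RoyAdmissible` (`u < s₀`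
versus `s₀ < u`), and it does satisfy the window of the vendored `Roy2001_prop3`
(`max{1,t₀,2t₁} < min{s₀,2s₁} < u`), so the card's `⇒` direction is available from
`Roy2001_prop3_holds` as claimed; the `⇐` direction is its new analytic lemma. Both facts are
exponent arithmetic, checked here. -/

/-- Verbatim `Sketch.RoyAdmissibleBelow` (card identity-exact-window). -/
def RoyAdmissibleBelow (s₀ s₁ t₀ t₁ u : ℝ) : Prop :=
  0 < s₀ ∧ 0 < s₁ ∧ 0 < t₀ ∧ 0 < t₁ ∧ 0 < u ∧
    max 1 (max t₀ (2 * t₁)) < 2 * s₁ ∧ 2 * s₁ < u ∧ u < s₀ ∧ s₁ + t₁ < s₀ ∧ s₀ < (1 + t₀ + t₁) / 2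

/-- `R''` lies in the window of Roy's Proposition 3 as vendored (`Roy2001_prop3`). [folklore] -/
theorem prop3_window_of_below {s₀ s₁ t₀ t₁ u : ℝ} (h : RoyAdmissibleBelow s₀ s₁ t₀ t₁ u) :
    max 1 (max t₀ (2 * t₁)) < min s₀ (2 * s₁) ∧ min s₀ (2 * s₁) < u := by
  obtain ⟨-, -, -, -, -, hmax, h2u, hus, -, -⟩ := h
  have hmin : min s₀ (2 * s₁) = 2 * s₁ := min_eq_right (by linarith)
  rw [hmin]
  exact ⟨hmax, h2u⟩

/-- `R''` and Roy's window (1) are disjoint: the card's `C⁼` is not a sub-case of the crux but a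
neighbouring parameter region, equivalent to it only through Schanuel. [folklore] -/
theorem below_disjoint_admissible {s₀ s₁ t₀ t₁ u : ℝ} (h : RoyAdmissibleBelow s₀ s₁ t₀ t₁ u) :
    ¬ RoyAdmissible s₀ s₁ t₀ t₁ u := by
  rintro ⟨-, -, -, -, -, -, hsu, -⟩
  obtain ⟨-, -, -, -, -, -, -, hus, -, -⟩ := h
  have : s₀ < u := lt_of_le_of_lt (le_max_left _ _) hsu
  linarith

end TriageR1K2

end
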